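import Summits.CriticalPhenomena.PercolationContinuityZ3.Theorems.Transplant.FKConnectivityAllQApexCases
import HarnessLib

/-!
# Connectivity correlation inequalities for `φ_{w,q}`, every `q > 0` — file 9d: apex elimination, MARGINALISATION AND THE STEP
# (pairs off the apex; the base case; the apex step of the induction)

Support file (`--supports stmt-CriticalPhenomena-4575`), FK sub-lane `prim-bschramm-fk-1` (gen 5) of the post-continuity
programme; builds on p205010 (kernel theorem, internal audit signed; external expert review pending).  No definitions, no named
facts, no sorries; standard axioms.

THE ARGUMENT (files `…ApexTools`, `…ApexMass`, `…ApexCases`, `…ApexStep`, `…TwoTree`).  Wagner (Ann. Comb. 2008, Ex. 5.1 +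
Thm. 5.8(d) + §5.3) proves that the random-cluster (Potts) model with `0 < q ≤ 1` is Rayleigh — edge-negatively associated,
`φ(J_e ∩ J_f) ≤ φ(J_e)φ(J_f)` (Grimmett 2006 §3.9 (3.94)) — on every series–parallel graph, by induction over two-sums.  We prove the
graph case by APEX ELIMINATION over 2-trees (whose subgraphs are exactly the series–parallel = `K₄`-minor-free graphs): a 2-tree
is `{uv}` or `T ∪ {ux, xv}` with `uv ∈ T` and `x` fresh; for a weight vector `w` supported in `T ∪ {ux, xv}` write `a = ux`,
`b = xv`, `g = uv`, `w° = w[a↦0][b↦0]` and `K' = {u ↔ v avoiding a, b}`.  Three exact identities for events `F` insensitive to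
`a, b` (file `…ApexMass`): `S_w(F) = ((1−p_a)+p_a q⁻¹)((1−p_b)+p_b q⁻¹)·S°(F) − p_a p_b q⁻¹(q⁻¹−1)·S°(F ∩ K')`,
`S_w(J_b ∩ F ∩ K') = p_b q⁻¹·S°(F ∩ K')`, `S_w(J_a ∩ J_b ∩ F) = p_a p_b (q⁻¹ S°(F) + (q⁻¹−1)q⁻¹ S°(F ∩ K'ᶜ))`.  With fk-2's
master identity (`negCorr_defect_eq`: `Cov(J_e, J_f) ≤ 0 ⟺` opening `f` does not lower `φ_{w[e↦0]}(x ↔ y)`, `e = xy`) every pair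
reduces to EC⁺ for `u ↔ v` one level down, i.e. to negative association on `T` (file `…ApexCases`): `(a, f)`:
`φ_{w[a↦0][f↦s]}(u ↔ x) = θ·φ_{w°[f↦s]}(u ↔ v)`; `(g, f)`: `φ_{w[g↦0][f↦s]}(u ↔ v)` is an increasing Möbius function of
`φ_{w°[g↦0][f↦s]}(u ↔ v)`; `(a, b)`, `(a, g)`: unconditional; and pairs `e, f ⊆ T ∖ g` are MARGINALISED (file `…ApexStep`):
`S_w(E) = α·S_{w°[g↦c]}(E)` for `E ∈ {J_e ∩ J_f, J_e, J_f, Ω}` with `α = (1−p_a)(1−p_b) + (p_a+p_b−p_ap_b)q⁻¹` and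
`α c = α p_g + (1−p_g)p_a p_b q⁻¹` (the path `u–x–v` is a pair `uv` in parallel with `g`).

THIS FILE: `apex_marginal` (`S_w(E) = α·S_{w°[g↦c]}(E)` for `E` insensitive to `a, b, g`), `negCorr_off_apex`, the base
`edgeNegCorr_supp_pair` and the step `edgeNegCorr_supp_apex_step`: negative association for all weight vectors supported in a
loopless `T ∋ uv` (`0 < q < 1`) implies it for all weight vectors supported in `T ∪ {ux, xv}`, `x` fresh.  The induction over
2-trees is run in `…AllQTwoTree.lean` (which carries the definition of a 2-tree).
[cite: Wagner2006, Ex. 5.1, Thm. 5.8(d), §5.3] [cite: Grimmett2006, §3.9 eq. (3.94) (pp. 63–64); Thm. (3.1)(a) (p. 37)]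
-/

noncomputable section

namespace Summit.CriticalPhenomena.PercolationContinuityZ3.Theorems

namespace FK

open MeasureTheory Set Literature.Probability.LatticeModels Literature.Probability.Percolation
open Literature.Probability.Percolation.DecisionTree (ind ind_of_mem ind_of_not_mem ind_nonneg)
open Literature.Probability.Percolation.TwoAvoidanceSets (ind_mul_ind)
open scoped Classical symmDiff

variable {V : Type*} [Fintype V]

/-! ### Case (r): pairs off the apex and off the base pair — marginalising the apex -/

/-- **Marginalising the apex**: for an event `E` insensitive to the apex pairs and to the base pair `g = s(u,v)`,
`S_w(E) = α·S_{w°[g↦c]}(E)`, where `α = (1 − w a)(1 − w b) + (w a + w b − (w a)(w b))q⁻¹` and the new parameter `c` of `g`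
solves `α·c = α·(w g) + (1 − w g)(w a)(w b)q⁻¹` (the path `u – x – v` acts on the rest of the graph as an extra pair `uv` in
parallel with `g`). [cite: Grimmett2006, Thm. (3.1)(a) (p. 37); §1.4 eq. (1.20) (p. 15)] -/
theorem apex_marginal (w : Sym2 V → unitInterval) {q : ℝ} (hq : q ≠ 0) {u v x : V} (hxu : x ≠ u) (hxv : x ≠ v)
    (huv : u ≠ v) (hw : ∀ e : Sym2 V, x ∈ e → ((w e : unitInterval) : ℝ) ≠ 0 → u ∈ e ∨ v ∈ e)
    (E : Set (BondConfig V)) (hEa : ∀ ω : BondConfig V, ω ∆ {s(u, x)} ∈ E ↔ ω ∈ E)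
    (hEb : ∀ ω : BondConfig V, ω ∆ {s(x, v)} ∈ E ↔ ω ∈ E) (hEg : ∀ ω : BondConfig V, ω ∆ {s(u, v)} ∈ E ↔ ω ∈ E)
    (c : unitInterval)
    (hc : ((1 - ((w s(u, x) : unitInterval) : ℝ)) * (1 - ((w s(x, v) : unitInterval) : ℝ)) +
        (((w s(u, x) : unitInterval) : ℝ) + ((w s(x, v) : unitInterval) : ℝ) -
          ((w s(u, x) : unitInterval) : ℝ) * ((w s(x, v) : unitInterval) : ℝ)) * q⁻¹) * (c : ℝ) =
      ((1 - ((w s(u, x) : unitInterval) : ℝ)) * (1 - ((w s(x, v) : unitInterval) : ℝ)) +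
        (((w s(u, x) : unitInterval) : ℝ) + ((w s(x, v) : unitInterval) : ℝ) -
          ((w s(u, x) : unitInterval) : ℝ) * ((w s(x, v) : unitInterval) : ℝ)) * q⁻¹) * ((w s(u, v) : unitInterval) : ℝ) +
        (1 - ((w s(u, v) : unitInterval) : ℝ)) * ((w s(u, x) : unitInterval) : ℝ) * ((w s(x, v) : unitInterval) : ℝ) * q⁻¹) :
    ∑ ω : BondConfig V, rcWeightW w q ∅ ω * ind E ω =
      ((1 - ((w s(u, x) : unitInterval) : ℝ)) * (1 - ((w s(x, v) : unitInterval) : ℝ)) +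
        (((w s(u, x) : unitInterval) : ℝ) + ((w s(x, v) : unitInterval) : ℝ) -
          ((w s(u, x) : unitInterval) : ℝ) * ((w s(x, v) : unitInterval) : ℝ)) * q⁻¹) *
        ∑ ω : BondConfig V, rcWeightW (Function.update (Function.update (Function.update w s(u, x) 0) s(x, v) 0) s(u, v) c)
          q ∅ ω * ind E ω := by
  have hab := apex_pairs_ne hxu huv
  have hgx : x ∉ s(u, v) := by
    rw [Sym2.mem_iff]; rintro (h | h); exacts [hxu h, hxv h]
  have hga : s(u, v) ≠ s(u, x) := fun h => hgx (h ▸ Sym2.mem_mk_right u x)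
  have hgb : s(u, v) ≠ s(x, v) := fun h => hgx (h ▸ Sym2.mem_mk_left x v)
  set K : Set (BondConfig V) := {ω : BondConfig V | ω \ {s(u, x), s(x, v)} ∈ (openConn u v : Set (BondConfig V))} with hK
  -- the apex identity
  have hA1 := apex_mass w hq hxu hxv huv hw E hEa hEb
  -- notation for the apex-deleted vector `w°` and the states `D_t = w°[g↦t]`
  set w0 := Function.update (Function.update w s(u, x) 0) s(x, v) 0 with hw0def
  have hw0 : ∀ e : Sym2 V, x ∈ e → ((w0 e : unitInterval) : ℝ) ≠ 0 → u ∈ e ∨ v ∈ e :=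
    apex_hyp_update (apex_hyp_update hw s(u, x) (fun _ => Or.inl (Sym2.mem_mk_left u x)) 0) s(x, v)
      (fun _ => Or.inr (Sym2.mem_mk_right x v)) 0
  have hg0 : ((w0 s(u, v) : unitInterval) : ℝ) = ((w s(u, v) : unitInterval) : ℝ) := by
    rw [hw0def, Function.update_of_ne hgb, Function.update_of_ne hga]
  have hwD : ∀ t : unitInterval, ∀ e : Sym2 V, x ∈ e → ((Function.update w0 s(u, v) t e : unitInterval) : ℝ) ≠ 0 → u ∈ e ∨ v ∈ e :=
    fun t => apex_hyp_update hw0 s(u, v) (fun h => absurd h hgx) t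
  have haD : ∀ t : unitInterval, ((Function.update w0 s(u, v) t s(u, x) : unitInterval) : ℝ) = 0 := by
    intro t; rw [Function.update_of_ne hga.symm, hw0def, Function.update_of_ne hab]; simp
  have hbD : ∀ t : unitInterval, ((Function.update w0 s(u, v) t s(x, v) : unitInterval) : ℝ) = 0 := by
    intro t; rw [Function.update_of_ne hgb.symm, hw0def]; simp
  -- expansions at `g`
  have e2 := sum_rcWeightW_ind_affine w0 q s(u, v) E
  have e3 := sum_rcWeightW_ind_affine w0 q s(u, v) (E ∩ K)
  have e6 := sum_rcWeightW_update_one_eq_toggle w0 hq u v E hEg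
  have e7 := sum_rcWeightW_ind_inter_compl (Function.update w0 s(u, v) 0) q E (openConn u v : Set (BondConfig V))
  -- under `D_1`, `g` is a.s. open, so `K` holds a.s.
  have e4 : ∑ ω : BondConfig V, rcWeightW (Function.update w0 s(u, v) 1) q ∅ ω * ind (E ∩ K) ω =
      ∑ ω : BondConfig V, rcWeightW (Function.update w0 s(u, v) 1) q ∅ ω * ind E ω := by
    refine sum_rcWeightW_ind_congr_ae _ q fun ω hω => ?_
    have hg : s(u, v) ∈ ω := mem_of_rcWeightW_ne_zero _ q (by simp) hω
    have hgK : ω ∈ K := by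
      rw [hK, Set.mem_setOf_eq, mem_openConn_iff']
      have hmem : s(u, v) ∈ ω \ {s(u, x), s(x, v)} := by
        refine ⟨hg, ?_⟩
        rintro (h | h)
        · exact hga h
        · exact hgb h
      have hadj : (openGraph (ω \ {s(u, x), s(x, v)})).Adj u v := by rw [openGraph_adj]; exact ⟨hmem, huv⟩
      exact hadj.reachable
    exact ⟨fun h => h.1, fun h => ⟨h, hgK⟩⟩
  -- under `D_0`, `x` is a.s. isolated, so `K` iff `u ↔ v`
  have e5 : ∑ ω : BondConfig V, rcWeightW (Function.update w0 s(u, v) 0) q ∅ ω * ind (E ∩ K) ω =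
      ∑ ω : BondConfig V, rcWeightW (Function.update w0 s(u, v) 0) q ∅ ω * ind (E ∩ (openConn u v : Set (BondConfig V))) ω := by
    refine sum_rcWeightW_ind_congr_ae _ q fun ω hω => ?_
    have hapex := apex_of_rcWeightW_ne_zero _ q hxu hxv (hwD 0) hω
    have ha : s(u, x) ∉ ω := not_mem_of_rcWeightW_ne_zero _ q (haD 0) hω
    rw [Set.mem_inter_iff, Set.mem_inter_iff, hK, Set.mem_setOf_eq, mem_openConn_iff', mem_openConn_iff',
      reachable_uv_apex_iff hxu hxv hapex]
    simp only [ha, false_and, or_false]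
  -- the marginal vector `w°[g↦c]` expanded at `g`
  have e8 := sum_rcWeightW_ind_affine (Function.update w0 s(u, v) c) q s(u, v) E
  rw [Function.update_idem, Function.update_idem] at e8
  simp only [Function.update_self] at e8
  rw [hg0] at e2 e3
  rw [hA1, e8, e2, e3, e4, e5, e6, e7]
  linear_combination (-((q⁻¹ - 1) *
    (∑ ω : BondConfig V, rcWeightW (Function.update w0 s(u, v) 0) q ∅ ω * ind E ω -
      ∑ ω : BondConfig V, rcWeightW (Function.update w0 s(u, v) 0) q ∅ ω * ind (E ∩ (openConn u v : Set (BondConfig V))) ω))) * hc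


/-- **Two pairs off the apex and off the base pair are negatively associated under `φ_w` as soon as they are under the marginal
vector `w°[g↦c]`** (for every `c`; only the solution of `α c = α (w g) + (1 − w g)(w a)(w b)q⁻¹` is used).
[cite: Grimmett2006, §3.9 eq. (3.94) (p. 63); Thm. (3.1)(a) (p. 37)] -/
theorem negCorr_off_apex {q : ℝ} (hq0 : 0 < q) (hq1 : q ≤ 1) (w : Sym2 V → unitInterval) {u v x : V} (hxu : x ≠ u)
    (hxv : x ≠ v) (huv : u ≠ v) (hw : ∀ e : Sym2 V, x ∈ e → ((w e : unitInterval) : ℝ) ≠ 0 → u ∈ e ∨ v ∈ e)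
    {e f : Sym2 V} (hex : x ∉ e) (hfx : x ∉ f) (heg : e ≠ s(u, v)) (hfg : f ≠ s(u, v))
    (hNC : ∀ c : unitInterval,
      (rcMeasureW (Function.update (Function.update (Function.update w s(u, x) 0) s(x, v) 0) s(u, v) c) q ∅).real
          ({ω | e ∈ ω} ∩ {ω | f ∈ ω}) ≤
        (rcMeasureW (Function.update (Function.update (Function.update w s(u, x) 0) s(x, v) 0) s(u, v) c) q ∅).real
            {ω | e ∈ ω} *
          (rcMeasureW (Function.update (Function.update (Function.update w s(u, x) 0) s(x, v) 0) s(u, v) c) q ∅).real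
            {ω | f ∈ ω}) :
    (rcMeasureW w q ∅).real ({ω | e ∈ ω} ∩ {ω | f ∈ ω}) ≤
      (rcMeasureW w q ∅).real {ω | e ∈ ω} * (rcMeasureW w q ∅).real {ω | f ∈ ω} := by
  have hea : e ≠ s(u, x) := fun h => hex (h ▸ Sym2.mem_mk_right u x)
  have heb : e ≠ s(x, v) := fun h => hex (h ▸ Sym2.mem_mk_left x v)
  have hfa : f ≠ s(u, x) := fun h => hfx (h ▸ Sym2.mem_mk_right u x)
  have hfb : f ≠ s(x, v) := fun h => hfx (h ▸ Sym2.mem_mk_left x v)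
  -- the parameters
  set p₁ : ℝ := ((w s(u, x) : unitInterval) : ℝ) with hp₁
  set p₂ : ℝ := ((w s(x, v) : unitInterval) : ℝ) with hp₂
  set p₀ : ℝ := ((w s(u, v) : unitInterval) : ℝ) with hp₀
  have hp₁0 : 0 ≤ p₁ := (w s(u, x)).2.1
  have hp₁1 : p₁ ≤ 1 := (w s(u, x)).2.2
  have hp₂0 : 0 ≤ p₂ := (w s(x, v)).2.1
  have hp₂1 : p₂ ≤ 1 := (w s(x, v)).2.2
  have hp₀0 : 0 ≤ p₀ := (w s(u, v)).2.1
  have hp₀1 : p₀ ≤ 1 := (w s(u, v)).2.2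
  have hr1 : 1 ≤ q⁻¹ := one_le_inv_iff₀.2 ⟨hq0, hq1⟩
  set α : ℝ := (1 - p₁) * (1 - p₂) + (p₁ + p₂ - p₁ * p₂) * q⁻¹ with hα
  have hα1 : 1 ≤ α := by
    have h1 : 0 ≤ p₁ + p₂ - p₁ * p₂ := by nlinarith
    have h2 : 0 ≤ (p₁ + p₂ - p₁ * p₂) * (q⁻¹ - 1) := mul_nonneg h1 (by linarith)
    have h3 : α = 1 + (p₁ + p₂ - p₁ * p₂) * (q⁻¹ - 1) := by rw [hα]; ring
    linarith
  have hαpos : 0 < α := by linarith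
  have hnum0 : 0 ≤ (1 - p₀) * p₁ * p₂ * q⁻¹ := by
    have : 0 ≤ 1 - p₀ := by linarith
    have : 0 ≤ q⁻¹ := by linarith
    positivity
  have hnum1 : (1 - p₀) * p₁ * p₂ * q⁻¹ ≤ (1 - p₀) * α := by
    have h1 : p₁ * p₂ * q⁻¹ ≤ α := by
      have h2 : α - p₁ * p₂ * q⁻¹ = (1 - p₁) * (1 - p₂) + ((1 - p₁) * p₂ + p₁ * (1 - p₂)) * q⁻¹ := by rw [hα]; ring
      have h3 : 0 ≤ (1 - p₁) * (1 - p₂) + ((1 - p₁) * p₂ + p₁ * (1 - p₂)) * q⁻¹ := by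
        have : 0 ≤ 1 - p₁ := by linarith
        have : 0 ≤ 1 - p₂ := by linarith
        have : 0 ≤ q⁻¹ := by linarith
        positivity
      linarith
    have h0 : 0 ≤ 1 - p₀ := by linarith
    nlinarith [mul_le_mul_of_nonneg_left h1 h0]
  set pr : ℝ := p₀ + (1 - p₀) * p₁ * p₂ * q⁻¹ / α with hpr
  have hpr0 : 0 ≤ pr := by rw [hpr]; positivity
  have hpr1 : pr ≤ 1 := by
    rw [hpr]
    have : (1 - p₀) * p₁ * p₂ * q⁻¹ / α ≤ 1 - p₀ := by
      rw [div_le_iff₀ hαpos]; exact hnum1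
    linarith
  set c : unitInterval := ⟨pr, hpr0, hpr1⟩ with hcdef
  have hc : α * (c : ℝ) = α * p₀ + (1 - p₀) * p₁ * p₂ * q⁻¹ := by
    change α * pr = _
    rw [hpr, mul_add, mul_div_assoc', mul_div_cancel_left₀ _ hαpos.ne']
  -- the marginal identities for the four events
  have hJe : ∀ g : Sym2 V, g ≠ e → ∀ ω : BondConfig V, ω ∆ {g} ∈ {ω : BondConfig V | e ∈ ω} ↔ ω ∈ {ω : BondConfig V | e ∈ ω} :=
    fun g hg ω => mem_symmDiff_singleton_of_ne ω hg.symm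
  have hJf : ∀ g : Sym2 V, g ≠ f → ∀ ω : BondConfig V, ω ∆ {g} ∈ {ω : BondConfig V | f ∈ ω} ↔ ω ∈ {ω : BondConfig V | f ∈ ω} :=
    fun g hg ω => mem_symmDiff_singleton_of_ne ω hg.symm
  have hU : ∀ g : Sym2 V, ∀ ω : BondConfig V, ω ∆ {g} ∈ (Set.univ : Set (BondConfig V)) ↔ ω ∈ (Set.univ : Set (BondConfig V)) :=
    fun g ω => by simp
  have m1 := apex_marginal w hq0.ne' hxu hxv huv hw ({ω | e ∈ ω} ∩ {ω | f ∈ ω})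
    (inter_insens (hJe _ hea.symm) (hJf _ hfa.symm)) (inter_insens (hJe _ heb.symm) (hJf _ hfb.symm))
    (inter_insens (hJe _ heg.symm) (hJf _ hfg.symm)) c hc
  have m2 := apex_marginal w hq0.ne' hxu hxv huv hw {ω | e ∈ ω} (hJe _ hea.symm) (hJe _ heb.symm) (hJe _ heg.symm) c hc
  have m3 := apex_marginal w hq0.ne' hxu hxv huv hw {ω | f ∈ ω} (hJf _ hfa.symm) (hJf _ hfb.symm) (hJf _ hfg.symm) c hc
  have m4 := apex_marginal w hq0.ne' hxu hxv huv hw Set.univ (hU _) (hU _) (hU _) c hc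
  rw [sum_rcWeightW_ind_univ, sum_rcWeightW_ind_univ] at m4
  -- transfer
  have h := (negCorr_real_iff_mass hq0 _ e f).1 (hNC c)
  rw [negCorr_real_iff_mass hq0, m1, m2, m3, m4]
  have hα0 : 0 ≤ α * α := mul_nonneg hαpos.le hαpos.le
  calc α * (∑ ω : BondConfig V, rcWeightW (Function.update (Function.update (Function.update w s(u, x) 0) s(x, v) 0)
          s(u, v) c) q ∅ ω * ind ({ω | e ∈ ω} ∩ {ω | f ∈ ω}) ω) *
        (α * rcPartitionFunctionW (Function.update (Function.update (Function.update w s(u, x) 0) s(x, v) 0) s(u, v) c) q ∅)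
      = α * α * ((∑ ω : BondConfig V, rcWeightW (Function.update (Function.update (Function.update w s(u, x) 0) s(x, v) 0)
          s(u, v) c) q ∅ ω * ind ({ω | e ∈ ω} ∩ {ω | f ∈ ω}) ω) *
          rcPartitionFunctionW (Function.update (Function.update (Function.update w s(u, x) 0) s(x, v) 0) s(u, v) c) q ∅) := by
        ring
    _ ≤ α * α * ((∑ ω : BondConfig V, rcWeightW (Function.update (Function.update (Function.update w s(u, x) 0) s(x, v) 0)
          s(u, v) c) q ∅ ω * ind {ω | e ∈ ω} ω) *
          ∑ ω : BondConfig V, rcWeightW (Function.update (Function.update (Function.update w s(u, x) 0) s(x, v) 0)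
            s(u, v) c) q ∅ ω * ind {ω | f ∈ ω} ω) := mul_le_mul_of_nonneg_left h hα0
    _ = _ := by ring

/-! ### The induction: base pair and apex step -/

/-- **Base**: on a single pair `{uv}` every two distinct pairs are negatively associated (one of them is dead).
[cite: Grimmett2006, §3.9 eq. (3.94) (p. 63)] -/
theorem edgeNegCorr_supp_pair {q : ℝ} (hq0 : 0 < q) (g : Sym2 V) :
    ∀ w : Sym2 V → unitInterval, (∀ e, ((w e : unitInterval) : ℝ) ≠ 0 → e ∈ ({g} : Set (Sym2 V))) →
      ∀ e f : Sym2 V, ¬ e.IsDiag → f ≠ e →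
        (rcMeasureW w q ∅).real ({ω | e ∈ ω} ∩ {ω | f ∈ ω}) ≤
          (rcMeasureW w q ∅).real {ω | e ∈ ω} * (rcMeasureW w q ∅).real {ω | f ∈ ω} := by
  intro w hw e f _ hfe
  by_cases he : ((w e : unitInterval) : ℝ) = 0
  · exact negCorr_of_weight_zero_left hq0 w f he
  by_cases hf : ((w f : unitInterval) : ℝ) = 0
  · exact negCorr_of_weight_zero_right hq0 w e hf
  have h1 : e = g := hw e he
  have h2 : f = g := hw f hf
  exact absurd (h2.trans h1.symm) hfe

omit [Fintype V] in
/-- The support of the apex-deleted vector lies in `T`. [folklore] -/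
theorem supp_apex_deleted {w : Sym2 V → unitInterval} {T : Set (Sym2 V)} {a b : Sym2 V}
    (hw : ∀ e, ((w e : unitInterval) : ℝ) ≠ 0 → e ∈ T ∪ {a, b}) :
    ∀ e, ((Function.update (Function.update w a 0) b 0 e : unitInterval) : ℝ) ≠ 0 → e ∈ T := by
  intro e he
  by_cases heb : e = b
  · subst heb; simp at he
  rw [Function.update_of_ne heb] at he
  by_cases hea : e = a
  · subst hea; simp at he
  rw [Function.update_of_ne hea] at he
  rcases hw e he with h | h
  · exact h
  · rcases h with h | h
    · exact absurd h hea
    · exact absurd h heb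

/-- **Apex step**: if every weight vector supported in the loopless edge set `T ∋ uv` is edge-negatively associated
(`0 < q < 1`) and `x` is not covered by `T`, then so is every weight vector supported in `T ∪ {ux, xv}`.
[cite: Wagner2006, Thm. 5.8(d), §5.3] [cite: Grimmett2006, §3.9 eq. (3.94) (p. 63)] -/
theorem edgeNegCorr_supp_apex_step {q : ℝ} (hq0 : 0 < q) (hq1 : q < 1) {T : Set (Sym2 V)} {u v x : V}
    (hTl : ∀ e ∈ T, ¬ e.IsDiag) (huvT : s(u, v) ∈ T) (hx : ∀ e ∈ T, x ∉ e)
    (hNC : ∀ w' : Sym2 V → unitInterval, (∀ e, ((w' e : unitInterval) : ℝ) ≠ 0 → e ∈ T) → ∀ e f : Sym2 V, ¬ e.IsDiag → f ≠ e →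
      (rcMeasureW w' q ∅).real ({ω | e ∈ ω} ∩ {ω | f ∈ ω}) ≤ (rcMeasureW w' q ∅).real {ω | e ∈ ω} * (rcMeasureW w' q ∅).real {ω | f ∈ ω}) :
    ∀ w : Sym2 V → unitInterval, (∀ e, ((w e : unitInterval) : ℝ) ≠ 0 → e ∈ T ∪ {s(u, x), s(x, v)}) →
      ∀ e f : Sym2 V, ¬ e.IsDiag → f ≠ e →
        (rcMeasureW w q ∅).real ({ω | e ∈ ω} ∩ {ω | f ∈ ω}) ≤
          (rcMeasureW w q ∅).real {ω | e ∈ ω} * (rcMeasureW w q ∅).real {ω | f ∈ ω} := by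
  intro w hw e f hediag hfe
  have huv : u ≠ v := fun h => hTl _ huvT (by rw [Sym2.mk_isDiag_iff]; exact h)
  have hxu : x ≠ u := fun h => hx _ huvT (by rw [h]; exact Sym2.mem_mk_left u v)
  have hxv : x ≠ v := fun h => hx _ huvT (by rw [h]; exact Sym2.mem_mk_right u v)
  have hab := apex_pairs_ne hxu huv
  have hgx : x ∉ s(u, v) := hx _ huvT
  -- the apex hypothesis for `w`
  have hapex : ∀ e' : Sym2 V, x ∈ e' → ((w e' : unitInterval) : ℝ) ≠ 0 → u ∈ e' ∨ v ∈ e' := by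
    intro e' hxe' hne
    rcases hw e' hne with h | h
    · exact absurd hxe' (hx e' h)
    · rcases h with rfl | rfl
      · exact Or.inl (Sym2.mem_mk_left u x)
      · exact Or.inr (Sym2.mem_mk_right x v)
  -- the apex-deleted vector and its support
  set w0 := Function.update (Function.update w s(u, x) 0) s(x, v) 0 with hw0def
  have hsupp0 : ∀ e', ((w0 e' : unitInterval) : ℝ) ≠ 0 → e' ∈ T := supp_apex_deleted hw
  -- EC⁺ inputs one level down
  have hECf : ∀ {f' : Sym2 V}, f' ∈ T →
      (rcMeasureW (Function.update w0 f' 0) q ∅).real (openConn u v) ≤ (rcMeasureW (Function.update w0 f' 1) q ∅).real (openConn u v) := by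
    intro f' hf'T
    by_cases hfg' : f' = s(u, v)
    · rw [hfg']; exact edgeConnMono_self hq0 w0 u v
    · exact edgeConnMono_of_negCorr_supp hq0 hq1 hNC huvT hf'T w0 hsupp0
  -- the apex pairs against anything
  have apex_case : ∀ e' f' : Sym2 V, (e' = s(u, x) ∨ e' = s(x, v)) → f' ≠ e' → ((w f' : unitInterval) : ℝ) ≠ 0 →
      (rcMeasureW w q ∅).real ({ω | e' ∈ ω} ∩ {ω | f' ∈ ω}) ≤
        (rcMeasureW w q ∅).real {ω | e' ∈ ω} * (rcMeasureW w q ∅).real {ω | f' ∈ ω} := by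
    intro e' f' he' hfe' hf'0
    -- where is `f'`?
    have hf'cases : f' ∈ T ∨ f' = s(u, x) ∨ f' = s(x, v) := by
      rcases hw f' hf'0 with h | h
      · exact Or.inl h
      · rcases h with h | h
        · exact Or.inr (Or.inl h)
        · exact Or.inr (Or.inr h)
    rcases he' with rfl | rfl
    · -- `e' = a`
      rcases hf'cases with hf'T | rfl | rfl
      · exact negCorr_apex_pair hq0 hq1.le w hxu hxv huv hapex (hx f' hf'T) (hECf hf'T)
      · exact absurd rfl hfe'
      · exact negCorr_apex_ab hq0 hq1.le w hxu hxv huv hapex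
    · -- `e' = b`: use the mirror apex `(v, u, x)`
      have hapex' : ∀ e'' : Sym2 V, x ∈ e'' → ((w e'' : unitInterval) : ℝ) ≠ 0 → v ∈ e'' ∨ u ∈ e'' :=
        fun e'' h1 h2 => (hapex e'' h1 h2).symm
      have hswap : Function.update (Function.update w s(v, x) 0) s(x, u) 0 = w0 := by
        rw [hw0def, Sym2.eq_swap (a := v), Sym2.eq_swap (a := x) (b := u), Function.update_comm hab.symm]
      have hb : s(x, v) = s(v, x) := Sym2.eq_swap
      rw [hb]
      rcases hf'cases with hf'T | rfl | rfl
      · refine negCorr_apex_pair hq0 hq1.le w hxv hxu huv.symm hapex' (hx f' hf'T) ?_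
        rw [hswap]
        have h := hECf hf'T
        rwa [openConn_comm] at h
      · have ha : s(u, x) = s(x, u) := Sym2.eq_swap
        rw [ha]
        exact negCorr_apex_ab hq0 hq1.le w hxv hxu huv.symm hapex'
      · exact absurd rfl hfe'
  -- main case analysis
  by_cases he0 : ((w e : unitInterval) : ℝ) = 0
  · exact negCorr_of_weight_zero_left hq0 w f he0
  by_cases hf0 : ((w f : unitInterval) : ℝ) = 0
  · exact negCorr_of_weight_zero_right hq0 w e hf0
  rcases hw e he0 with heT | heab
  · rcases hw f hf0 with hfT | hfab
    · -- both in `T`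
      have hex : x ∉ e := hx e heT
      have hfx : x ∉ f := hx f hfT
      by_cases heg : e = s(u, v)
      · subst heg
        exact negCorr_base_pair hq0 hq1.le w hxu hxv huv hapex hfx hfe
          (edgeConnMono_of_negCorr_supp hq0 hq1 hNC huvT hfT (Function.update w0 s(u, v) 0) (supp_update_mem hsupp0 huvT 0))
      by_cases hfg : f = s(u, v)
      · subst hfg
        exact negCorr_symm w (negCorr_base_pair hq0 hq1.le w hxu hxv huv hapex hex (fun h => hfe h.symm)
          (edgeConnMono_of_negCorr_supp hq0 hq1 hNC huvT heT (Function.update w0 s(u, v) 0) (supp_update_mem hsupp0 huvT 0)))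
      exact negCorr_off_apex hq0 hq1.le w hxu hxv huv hapex hex hfx heg hfg fun c =>
        hNC _ (supp_update_mem hsupp0 huvT c) e f hediag hfe
    · -- `f` is an apex pair
      have hfab' : f = s(u, x) ∨ f = s(x, v) := by
        rcases hfab with h | h
        · exact Or.inl h
        · exact Or.inr h
      exact negCorr_symm w (apex_case f e hfab' (fun h => hfe h.symm) he0)
  · have heab' : e = s(u, x) ∨ e = s(x, v) := by
      rcases heab with h | h
      · exact Or.inl h
      · exact Or.inr h
    exact apex_case e f heab' hfe hf0


end FK

end Summit.CriticalPhenomena.PercolationContinuityZ3.Theorems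

end
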